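import Summits.QuantumFields.YangMills.Theorems.BalabanUVNodesN19MGFJoinConverse
import Summits.QuantumFields.YangMills.Theorems.BalabanUVNodesN19ExpectationCurrencyTwoConstantsRate
import Mathlib.Analysis.Calculus.UniformLimitsDeriv

/-!
# BalabanUVNodes ∕ N19 (NE7 proper) — THE EXPECTATION CURRENCY AT EVERY SOURCE: under N19's DECL target the SOURCED expectations
# `s ↦ ⟨∏os⟩_{K,s} = G_K′(s)` converge on the open source window, uniformly on inner windows with the linear-log tail rate, and the
# continuum generating function `genFunLim` is `C¹` there, its derivative being the continuum sourced expectation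

Cell `pub-ymgap` (HUMAN RULING D-0062, Track A), R141 (C) WIDER STRATEGY seat `pub-ymgap-dag-n19-e` (strategy s3 «alternative currency»), gen 8,
second module; filed `--kind proof --supports` K3‴ `SpineGivenEndpointR13` = stmt-QuantumFields-19912 `--as helper` (route rev 17).  COUNT-NEUTRAL.
THEOREMS ONLY (0 `def`); imports this seat's `…N19MGFJoinConverse` (p497552: the one-class lin-log bound at every tilt, `cgf_tilted_mul`) and
`…N19ExpectationCurrencyTwoConstantsRate` (p482030: the generating-function tail `abs_genFun_add_sub_le_tail`, `tendsto_linlog_of_tendsto_zero`), and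
Mathlib's `Analysis/Calculus/UniformLimitsDeriv`; edits nothing.

WHAT THIS IS.  The expectation currency of N19's DECL target (`Spine.NE7.Target vol l₀ δ Z`: matching modulo constants on `|t| ≤ l₀` with a summable
remainder) so far read the string's generating functions `G_K = genFun (schemeZ S os) K` at their VALUES (tree `T4CauchySum.tendsto_genFun`,
`tendstoUniformlyOn_genFun`) and at the derivative AT THE ORIGIN (`G_K′(0) = ⟨∏os⟩_K`, p482030: limit + lin-log tail rate).  The SOURCED expectation
`⟨∏os⟩_{K,s} := ⟨∏os·e^{s∏os}⟩_K ∕ ⟨e^{s∏os}⟩_K = G_K′(s)` is the tilted mean of the product observable under the `K`-th Gibbs measure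
(`deriv_genFun_schemeZ_eq_tiltedMean`), and p497552's tilting lemma moves the two-constants road from `s = 0` to every inner source:
* ★ `exists_tendsto_deriv_genFun_of_target`: under `Target` alone (`0 ≤ l₀`), for every `l₁ < l₀` the sourced expectations converge for `|s| ≤ l₁`,
  with `|G_K′(s) − lim| ≤ (8e^{1+(l₀−l₁)}∕(l₀ − l₁))·τ_K·(1 + log⁺(2τ_K)⁻¹)` for EVERY `K`, `τ_K = Σ_j 2·vol·δ_{K+j}` the tree's tail — uniformly in `s`;
* `tendstoUniformlyOn_deriv_genFun_of_target`: the convergence is UNIFORM on `{s | |s| ≤ l₁}`;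
* ★★ `hasDerivAt_genFunLim_of_target` (+ `differentiableOn_genFunLim_of_target`, `deriv_genFunLim_of_target`): for every `|s| < l₀` the continuum
  generating function `T4CauchySum.genFunLim (schemeZ S os)` is DIFFERENTIABLE at `s` with derivative `lim_K G_K′(s)` — the continuum generating
  function of the string is differentiable on the open source window and its derivative IS the continuum sourced expectation (Mathlib
  `hasDerivAt_of_tendstoUniformlyOn` on an inner open window), and `continuousOn_deriv_genFunLim_of_target`: that derivative is CONTINUOUS on the
  open window (uniform limit of the continuous `G_K′`) — the continuum generating function is `C¹` there.
§1 is the generic layer [folklore] over probability spaces `μ K` and observables `|X K| ≤ B` whose cgf's are Cauchy with a tail `τ_K → 0` on `|t| ≤ l₀`: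
`abs_tiltedMean_add_sub_le_linlog` (pair `(K, K+n)` at every tilt `|s| ≤ l₁`, uniformly in `n`) · `exists_tendsto_tiltedMean` (limit + rate for every `K`)
· `tendstoUniformlyOn_tiltedMean` · `continuous_tiltedMean` · `continuousOn_lim_tiltedMean` · `hasDerivAt_lim_cgf` (the limit cgf is differentiable inside,
derivative = limit of the tilted means); §2 instantiates at the torus scheme.

HONEST FRAMING.  [folklore] complex analysis (two constants + Cauchy, p480837 BY NAME through p497552) + Mathlib uniform-limit calculus + bookkeeping BY
NAME over the tree's scheme objects; `Target` ∕ `MatchingModConstants` are HYPOTHESES (NE7 NOT PRINTED as a two-run statement for d = 4, NOT proved);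
nothing of Bałaban's is instantiated; N19 NOT discharged (0∕1); K3‴ NOT claimed; counts UNMOVED (5∕27).  Whether the logarithm in the rate can be removed
under `Target` alone is NOT decided here.  One finite four-torus programme at fixed `ε` — NOT ℝ⁴, NOT infinite volume, NOT OS, NOT a mass gap, NOT Clay.
0 `def`; 0 `sorry`; standard axioms; no decl below carries a cite tag.
-/

noncomputable section

open Set Metric Filter Topology MeasureTheory ProbabilityTheory

namespace Summit.QuantumFields.YangMills.BalabanUVNodes.N19SourcedResponse

open Literature.MathematicalPhysics.QuantumFieldTheory.Balaban1983to89
open T4CauchySum (MatchingModConstants genFun genFunLim tendsto_genFun)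
open T4GenFunBounds (schemeZ prodObs)
open Missing (TorusScheme)
open Summit.QuantumFields.BalabanUV.T4Continuum.Spine
open Summit.QuantumFields.BalabanUV.T4Continuum.NE1p.DressedMGFForm (tiltedMean deriv_cgf_eq_tiltedMean)
open Summit.QuantumFields.YangMills.BalabanUVNodes.N19MGFJoinConverse (abs_tiltedMean_sub_le_linlog_of_cgf_close)
open Summit.QuantumFields.YangMills.BalabanUVNodes.N19ExpectationCurrencyAtScheme (mul_nonneg_of_matchingModConstants)
open Summit.QuantumFields.YangMills.BalabanUVNodes.N19ExpectationCurrencyTwoConstantsRate (abs_genFun_add_sub_le_tail tendsto_linlog_of_tendsto_zero)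

/-! ## §1 Generic: a sequence of bounded observables whose cgf's are Cauchy with a tail `τ_K` has tilted means Cauchy at the lin-log rate,
uniformly on inner tilt windows; the limit cgf is differentiable inside [folklore] -/

section Generic

variable {Ω : ℕ → Type*} [∀ K, MeasurableSpace (Ω K)] {μ : ∀ K, Measure (Ω K)} [∀ K, IsProbabilityMeasure (μ K)]
  {X : ∀ K, Ω K → ℝ} {B l₀ l₁ : ℝ} {τ : ℕ → ℝ}

/-- **THE PAIR `(K, K+n)` AT EVERY TILT, UNIFORMLY IN `n`** [folklore].  Probability measures `μ K`, observables `|X K| ≤ B` measurable; if the cgf's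
are `τ_K`-close for all later indices (`|cgf (X (K+n)) (μ (K+n)) t − cgf (X K) (μ K) t| ≤ τ K` on `|t| ≤ l₀`, `0 ≤ τ`), then for `|s| ≤ l₁ < l₀`
`|tiltedMean (X (K+n)) (μ (K+n)) s − tiltedMean (X K) (μ K) s| ≤ 8e^{1+(l₀−l₁)B}·τ_K·(1 + log⁺(2τ_K)⁻¹)∕(l₀ − l₁)` — `…N19MGFJoinConverse` §2 with `c = 0`. -/
theorem abs_tiltedMean_add_sub_le_linlog (hXm : ∀ K, Measurable (X K)) (hX : ∀ K ω, |X K ω| ≤ B) (hl : l₁ < l₀) (hτ0 : ∀ K, 0 ≤ τ K)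
    (hτ : ∀ K n (t : ℝ), |t| ≤ l₀ → |cgf (X (K + n)) (μ (K + n)) t - cgf (X K) (μ K) t| ≤ τ K)
    (K n : ℕ) {s : ℝ} (hs : |s| ≤ l₁) :
    |tiltedMean (X (K + n)) (μ (K + n)) s - tiltedMean (X K) (μ K) s| ≤
      8 * Real.exp (1 + (l₀ - l₁) * B) * τ K * (1 + Real.posLog (2 * τ K)⁻¹) / (l₀ - l₁) :=
  abs_tiltedMean_sub_le_linlog_of_cgf_close (ν := μ K) (ν' := μ (K + n)) (hXm K) (hX K) (hXm (K + n)) (hX (K + n)) hl (hτ0 K)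
    (c := 0) (fun u hu => by simpa using hτ K n u hu) hs

/-- **TILTED MEANS CONVERGE AT EVERY INNER TILT, WITH THE LIN-LOG TAIL RATE** [folklore]: if moreover `τ_K → 0`, then for every `|s| ≤ l₁ < l₀` the tilted
means converge to a limit `m s` and `|tiltedMean (X K) (μ K) s − m s| ≤ 8e^{1+(l₀−l₁)B}·τ_K·(1 + log⁺(2τ_K)⁻¹)∕(l₀ − l₁)` for EVERY `K`. -/
theorem exists_tendsto_tiltedMean (hXm : ∀ K, Measurable (X K)) (hX : ∀ K ω, |X K ω| ≤ B) (hl : l₁ < l₀) (hτ0 : ∀ K, 0 ≤ τ K)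
    (hτ : ∀ K n (t : ℝ), |t| ≤ l₀ → |cgf (X (K + n)) (μ (K + n)) t - cgf (X K) (μ K) t| ≤ τ K)
    (hτlim : Tendsto τ atTop (𝓝 0)) :
    ∃ m : ℝ → ℝ, ∀ s : ℝ, |s| ≤ l₁ → Tendsto (fun K => tiltedMean (X K) (μ K) s) atTop (𝓝 (m s)) ∧
      ∀ K, |tiltedMean (X K) (μ K) s - m s| ≤ 8 * Real.exp (1 + (l₀ - l₁) * B) * τ K * (1 + Real.posLog (2 * τ K)⁻¹) / (l₀ - l₁) := by
  set Φ : ℕ → ℝ := fun K => 8 * Real.exp (1 + (l₀ - l₁) * B) * τ K * (1 + Real.posLog (2 * τ K)⁻¹) / (l₀ - l₁) with hΦ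
  -- the lin-log bound tends to zero
  have hΦlim : Tendsto Φ atTop (𝓝 0) := by
    have h2τ0 : ∀ K, 0 ≤ 2 * τ K := fun K => mul_nonneg two_pos.le (hτ0 K)
    have h2τ : Tendsto (fun K => 2 * τ K) atTop (𝓝 0) := by simpa using hτlim.const_mul 2
    have h := tendsto_linlog_of_tendsto_zero h2τ0 h2τ (4 * Real.exp (1 + (l₀ - l₁) * B) / (l₀ - l₁))
    refine h.congr fun K => ?_
    simp only [hΦ]; ring
  have hpair : ∀ K n (s : ℝ), |s| ≤ l₁ → |tiltedMean (X (K + n)) (μ (K + n)) s - tiltedMean (X K) (μ K) s| ≤ Φ K :=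
    fun K n s hs => abs_tiltedMean_add_sub_le_linlog hXm hX hl hτ0 hτ K n hs
  have hc : ∀ s : ℝ, |s| ≤ l₁ → CauchySeq fun K => tiltedMean (X K) (μ K) s := fun s hs => by
    refine Metric.cauchySeq_iff'.2 fun ε hε => ?_
    obtain ⟨N, hN⟩ := (hΦlim.eventually (Iio_mem_nhds hε)).exists
    refine ⟨N, fun n hn => ?_⟩
    obtain ⟨k, rfl⟩ := Nat.exists_eq_add_of_le hn
    rw [Real.dist_eq]
    exact (hpair N k s hs).trans_lt hN
  refine ⟨fun s => limUnder atTop fun K => tiltedMean (X K) (μ K) s, fun s hs => ?_⟩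
  have hE := (hc s hs).tendsto_limUnder
  refine ⟨hE, fun K => ?_⟩
  set E := limUnder atTop fun K => tiltedMean (X K) (μ K) s
  have hEK : Tendsto (fun n => tiltedMean (X (K + n)) (μ (K + n)) s) atTop (𝓝 E) := by
    have h := (tendsto_add_atTop_iff_nat (f := fun j => tiltedMean (X j) (μ j) s) K).2 hE
    have e : (fun n => tiltedMean (X (n + K)) (μ (n + K)) s) = fun n => tiltedMean (X (K + n)) (μ (K + n)) s := by
      funext n; rw [add_comm]
    rwa [e] at h
  have habs : Tendsto (fun n => |tiltedMean (X (K + n)) (μ (K + n)) s - tiltedMean (X K) (μ K) s|) atTop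
      (𝓝 |E - tiltedMean (X K) (μ K) s|) := (hEK.sub_const _).abs
  rw [abs_sub_comm]
  exact le_of_tendsto' habs fun n => hpair K n s hs

/-- **UNIFORMLY ON THE INNER WINDOW** [folklore]: the convergence of the tilted means is uniform on `{s | |s| ≤ l₁}` (the rate does not depend on `s`). -/
theorem tendstoUniformlyOn_tiltedMean (hXm : ∀ K, Measurable (X K)) (hX : ∀ K ω, |X K ω| ≤ B) (hl : l₁ < l₀) (hτ0 : ∀ K, 0 ≤ τ K)
    (hτ : ∀ K n (t : ℝ), |t| ≤ l₀ → |cgf (X (K + n)) (μ (K + n)) t - cgf (X K) (μ K) t| ≤ τ K)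
    (hτlim : Tendsto τ atTop (𝓝 0)) :
    TendstoUniformlyOn (fun K s => tiltedMean (X K) (μ K) s) (fun s => limUnder atTop fun K => tiltedMean (X K) (μ K) s) atTop
      {s | |s| ≤ l₁} := by
  obtain ⟨m, hm⟩ := exists_tendsto_tiltedMean hXm hX hl hτ0 hτ hτlim
  have hlim : ∀ s : ℝ, |s| ≤ l₁ → (limUnder atTop fun K => tiltedMean (X K) (μ K) s) = m s :=
    fun s hs => (hm s hs).1.limUnder_eq
  have hΦlim : Tendsto (fun K => 8 * Real.exp (1 + (l₀ - l₁) * B) * τ K * (1 + Real.posLog (2 * τ K)⁻¹) / (l₀ - l₁)) atTop (𝓝 0) := by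
    have h2τ0 : ∀ K, 0 ≤ 2 * τ K := fun K => mul_nonneg two_pos.le (hτ0 K)
    have h2τ : Tendsto (fun K => 2 * τ K) atTop (𝓝 0) := by simpa using hτlim.const_mul 2
    refine (tendsto_linlog_of_tendsto_zero h2τ0 h2τ (4 * Real.exp (1 + (l₀ - l₁) * B) / (l₀ - l₁))).congr fun K => ?_
    ring
  rw [Metric.tendstoUniformlyOn_iff]
  intro ε hε
  filter_upwards [hΦlim.eventually (Iio_mem_nhds hε)] with K hK s hs
  rw [hlim s hs, Real.dist_eq, abs_sub_comm]
  exact ((hm s hs).2 K).trans_lt hK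

/-- The tilted mean of a bounded measurable observable under a finite measure is CONTINUOUS in the tilt (it is the derivative of the real-analytic
cgf, `T4GenFunBounds.analyticAt_cgf_of_abs_le`). [folklore] -/
theorem continuous_tiltedMean {Ω' : Type*} [MeasurableSpace Ω'] {ν : Measure Ω'} [IsFiniteMeasure ν] {Y : Ω' → ℝ} (hYm : Measurable Y)
    (hY : ∀ ω, |Y ω| ≤ B) : Continuous (tiltedMean Y ν) := by
  have e : tiltedMean Y ν = deriv (cgf Y ν) := funext fun s => (deriv_cgf_eq_tiltedMean hYm hY s).symm
  rw [e]
  exact continuous_iff_continuousAt.2 fun s =>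
    (T4GenFunBounds.analyticAt_cgf_of_abs_le hYm.aemeasurable (ae_of_all _ hY) s).deriv.continuousAt

/-- **THE LIMIT OF THE TILTED MEANS IS CONTINUOUS ON THE INNER WINDOW** (uniform limit of continuous functions). [folklore] -/
theorem continuousOn_lim_tiltedMean (hXm : ∀ K, Measurable (X K)) (hX : ∀ K ω, |X K ω| ≤ B) (hl : l₁ < l₀) (hτ0 : ∀ K, 0 ≤ τ K)
    (hτ : ∀ K n (t : ℝ), |t| ≤ l₀ → |cgf (X (K + n)) (μ (K + n)) t - cgf (X K) (μ K) t| ≤ τ K)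
    (hτlim : Tendsto τ atTop (𝓝 0)) :
    ContinuousOn (fun s => limUnder atTop fun K => tiltedMean (X K) (μ K) s) {s | |s| ≤ l₁} :=
  (tendstoUniformlyOn_tiltedMean hXm hX hl hτ0 hτ hτlim).continuousOn
    (Frequently.of_forall fun K => (continuous_tiltedMean (hXm K) (hX K)).continuousOn)

/-- **THE LIMIT CGF IS DIFFERENTIABLE INSIDE THE WINDOW; ITS DERIVATIVE IS THE LIMIT OF THE TILTED MEANS** [folklore].  If in addition the cgf's themselves
converge on `|t| ≤ l₀` to `g t`, then for every `|s| < l₀`: `HasDerivAt g (lim_K tiltedMean (X K) (μ K) s) s` (Mathlib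
`hasDerivAt_of_tendstoUniformlyOn` on an inner open window; `(cgf)′ = tiltedMean`). -/
theorem hasDerivAt_lim_cgf (hXm : ∀ K, Measurable (X K)) (hX : ∀ K ω, |X K ω| ≤ B) (hτ0 : ∀ K, 0 ≤ τ K)
    (hτ : ∀ K n (t : ℝ), |t| ≤ l₀ → |cgf (X (K + n)) (μ (K + n)) t - cgf (X K) (μ K) t| ≤ τ K)
    (hτlim : Tendsto τ atTop (𝓝 0)) {g : ℝ → ℝ} (hg : ∀ t : ℝ, |t| ≤ l₀ → Tendsto (fun K => cgf (X K) (μ K) t) atTop (𝓝 (g t)))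
    {s : ℝ} (hs : |s| < l₀) :
    HasDerivAt g (limUnder atTop fun K => tiltedMean (X K) (μ K) s) s := by
  -- an inner open window `|x| < l₁` with `|s| < l₁ < l₀`
  obtain ⟨l₁, hsl₁, hl⟩ := exists_between hs
  have hopen : IsOpen {x : ℝ | |x| < l₁} := isOpen_lt continuous_abs continuous_const
  have hU := (tendstoUniformlyOn_tiltedMean hXm hX hl hτ0 hτ hτlim).mono (fun x (hx : |x| < l₁) => (le_of_lt hx : |x| ≤ l₁))
  refine hasDerivAt_of_tendstoUniformlyOn hopen hU (Eventually.of_forall fun K x _ => ?_) (fun x hx => hg x ?_) hsl₁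
  · rw [← deriv_cgf_eq_tiltedMean (hXm K) (hX K) x]
    exact (T4GenFunBounds.differentiable_cgf_of_abs_le (hXm K).aemeasurable (ae_of_all _ (hX K)) x).hasDerivAt
  · exact (le_of_lt hx).trans hl.le

end Generic

/-! ## §2 At the torus scheme under N19's DECL target: sourced expectations converge on the open window with the lin-log tail rate, and the
continuum generating function is differentiable there [bookkeeping] -/

section Scheme

variable {G : Type*} [GaugeGroup G] [MeasurableSpace G] [RegularGaugeGroup G] [HaarData G] {O : Type*}
  (S : TorusScheme G O) (hβ : ∀ K, 0 ≤ S.β K) (hm : ∀ K o, Measurable (S.obs K o))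
  (h1 : ∀ K o U, |S.obs K o U| ≤ 1)
include hβ hm h1

/-- **THE SOURCED EXPECTATION IS THE DERIVATIVE OF THE GENERATING FUNCTION AT THE SOURCE**: `G_K′(s) = tiltedMean (∏os) (gibbs_K) s =
⟨∏os·e^{s∏os}⟩_K ∕ ⟨e^{s∏os}⟩_K` for every `K`, `s` (`genFun_schemeZ_eq_cgf`, `deriv_cgf_eq_tiltedMean`). [folklore] -/
theorem deriv_genFun_schemeZ_eq_tiltedMean (K : ℕ) (os : List O) (s : ℝ) :
    deriv (genFun (schemeZ S os) K) s =
      tiltedMean (prodObs S K os) (T4GenFunBounds.gibbsMeasure (S.P K) (S.β K)) s := by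
  haveI := T4GenFunBounds.isProbabilityMeasure_gibbsMeasure (G := G) (S.P K) (hβ K)
  have hfun : genFun (schemeZ S os) K = cgf (prodObs S K os) (T4GenFunBounds.gibbsMeasure (S.P K) (S.β K)) :=
    funext fun t => T4GenFunBounds.genFun_schemeZ_eq_cgf S hβ hm h1 K os t
  rw [hfun]
  exact deriv_cgf_eq_tiltedMean (T4GenFunBounds.measurable_prodObs S hm K os) (T4GenFunBounds.abs_prodObs_le_one S h1 K os) s

/-- ★ **SOURCED EXPECTATIONS CONVERGE ON INNER WINDOWS WITH THE LIN-LOG TAIL RATE, UNDER `Target` ALONE.**  If a string's dressed partition functions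
carry `Spine.NE7.Target vol l₀ δ (schemeZ S os)` (`0 ≤ l₀`), then for every `l₁ < l₀` there is `m : ℝ → ℝ` with, for all `|s| ≤ l₁`:
`G_K′(s) → m s` and `|G_K′(s) − m s| ≤ (8e^{1+(l₀−l₁)}∕(l₀ − l₁))·τ_K·(1 + log⁺(2τ_K)⁻¹)` for EVERY `K`, `τ_K = Σ_m 2·vol·δ_{K+m}` — the `s = 0` case is
`…TwoConstantsRate.abs_expectAt_sub_lim_le_linlog_tail_of_target` (with `l₁ = 0`, up to the constant).  `Target` is a HYPOTHESIS. [folklore] -/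
theorem exists_tendsto_deriv_genFun_of_target {vol l₀ l₁ : ℝ} {δ : ℕ → ℝ} (hl₀ : 0 ≤ l₀) (hl : l₁ < l₀) (os : List O)
    (hT : NE7.Target vol l₀ δ (schemeZ S os)) :
    ∃ m : ℝ → ℝ, ∀ s : ℝ, |s| ≤ l₁ → Tendsto (fun K => deriv (genFun (schemeZ S os) K) s) atTop (𝓝 (m s)) ∧
      ∀ K, |deriv (genFun (schemeZ S os) K) s - m s| ≤
        8 * Real.exp (1 + (l₀ - l₁)) * (∑' j, 2 * (vol * δ (K + j))) * (1 + Real.posLog (2 * ∑' j, 2 * (vol * δ (K + j)))⁻¹) / (l₀ - l₁) := by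
  obtain ⟨hM, hδ⟩ := hT
  haveI hP : ∀ K, IsProbabilityMeasure (T4GenFunBounds.gibbsMeasure (G := G) (S.P K) (S.β K)) := fun K =>
    T4GenFunBounds.isProbabilityMeasure_gibbsMeasure (G := G) (S.P K) (hβ K)
  have hτ0 : ∀ K, 0 ≤ ∑' j, 2 * (vol * δ (K + j)) := fun K =>
    tsum_nonneg fun j => mul_nonneg two_pos.le (mul_nonneg_of_matchingModConstants hl₀ hM (K + j))
  have hτlim : Tendsto (fun K => ∑' j, 2 * (vol * δ (K + j))) atTop (𝓝 0) := by
    have h := tendsto_sum_nat_add fun j => 2 * (vol * δ j)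
    refine h.congr fun i => tsum_congr fun k => by rw [add_comm]
  have hτ : ∀ K n (t : ℝ), |t| ≤ l₀ →
      |cgf (prodObs S (K + n) os) (T4GenFunBounds.gibbsMeasure (S.P (K + n)) (S.β (K + n))) t -
        cgf (prodObs S K os) (T4GenFunBounds.gibbsMeasure (S.P K) (S.β K)) t| ≤ ∑' j, 2 * (vol * δ (K + j)) := fun K n t ht => by
    rw [← T4GenFunBounds.genFun_schemeZ_eq_cgf S hβ hm h1, ← T4GenFunBounds.genFun_schemeZ_eq_cgf S hβ hm h1]
    exact abs_genFun_add_sub_le_tail hM hl₀ hδ ht K n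
  obtain ⟨m, hm'⟩ := exists_tendsto_tiltedMean (μ := fun K => T4GenFunBounds.gibbsMeasure (S.P K) (S.β K))
    (X := fun K => prodObs S K os) (fun K => T4GenFunBounds.measurable_prodObs S hm K os)
    (fun K => T4GenFunBounds.abs_prodObs_le_one S h1 K os) hl hτ0 hτ hτlim
  refine ⟨m, fun s hs => ?_⟩
  obtain ⟨hlim, hrate⟩ := hm' s hs
  refine ⟨?_, fun K => ?_⟩
  · simpa only [deriv_genFun_schemeZ_eq_tiltedMean S hβ hm h1] using hlim
  · simpa only [deriv_genFun_schemeZ_eq_tiltedMean S hβ hm h1, mul_one] using hrate K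

/-- **… UNIFORMLY ON THE INNER WINDOW**: under `Target`, the sourced expectations `s ↦ G_K′(s)` converge UNIFORMLY on `{s | |s| ≤ l₁}` for every
`l₁ < l₀` (the rate above does not depend on `s`). [folklore] -/
theorem tendstoUniformlyOn_deriv_genFun_of_target {vol l₀ l₁ : ℝ} {δ : ℕ → ℝ} (hl₀ : 0 ≤ l₀) (hl : l₁ < l₀) (os : List O)
    (hT : NE7.Target vol l₀ δ (schemeZ S os)) :
    TendstoUniformlyOn (fun K s => deriv (genFun (schemeZ S os) K) s)
      (fun s => limUnder atTop fun K => deriv (genFun (schemeZ S os) K) s) atTop {s | |s| ≤ l₁} := by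
  obtain ⟨hM, hδ⟩ := hT
  haveI hP : ∀ K, IsProbabilityMeasure (T4GenFunBounds.gibbsMeasure (G := G) (S.P K) (S.β K)) := fun K =>
    T4GenFunBounds.isProbabilityMeasure_gibbsMeasure (G := G) (S.P K) (hβ K)
  have hτ0 : ∀ K, 0 ≤ ∑' j, 2 * (vol * δ (K + j)) := fun K =>
    tsum_nonneg fun j => mul_nonneg two_pos.le (mul_nonneg_of_matchingModConstants hl₀ hM (K + j))
  have hτlim : Tendsto (fun K => ∑' j, 2 * (vol * δ (K + j))) atTop (𝓝 0) := by
    have h := tendsto_sum_nat_add fun j => 2 * (vol * δ j)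
    refine h.congr fun i => tsum_congr fun k => by rw [add_comm]
  have hτ : ∀ K n (t : ℝ), |t| ≤ l₀ →
      |cgf (prodObs S (K + n) os) (T4GenFunBounds.gibbsMeasure (S.P (K + n)) (S.β (K + n))) t -
        cgf (prodObs S K os) (T4GenFunBounds.gibbsMeasure (S.P K) (S.β K)) t| ≤ ∑' j, 2 * (vol * δ (K + j)) := fun K n t ht => by
    rw [← T4GenFunBounds.genFun_schemeZ_eq_cgf S hβ hm h1, ← T4GenFunBounds.genFun_schemeZ_eq_cgf S hβ hm h1]
    exact abs_genFun_add_sub_le_tail hM hl₀ hδ ht K n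
  have hU := tendstoUniformlyOn_tiltedMean (μ := fun K => T4GenFunBounds.gibbsMeasure (S.P K) (S.β K))
    (X := fun K => prodObs S K os) (fun K => T4GenFunBounds.measurable_prodObs S hm K os)
    (fun K => T4GenFunBounds.abs_prodObs_le_one S h1 K os) hl hτ0 hτ hτlim
  have e : ∀ K s, tiltedMean (prodObs S K os) (T4GenFunBounds.gibbsMeasure (S.P K) (S.β K)) s = deriv (genFun (schemeZ S os) K) s :=
    fun K s => (deriv_genFun_schemeZ_eq_tiltedMean S hβ hm h1 K os s).symm
  simpa only [e] using hU

/-- ★★ **THE CONTINUUM GENERATING FUNCTION IS DIFFERENTIABLE ON THE OPEN SOURCE WINDOW; ITS DERIVATIVE IS THE CONTINUUM SOURCED EXPECTATION.**  Under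
`Spine.NE7.Target vol l₀ δ (schemeZ S os)` (`0 < l₀`), for every `|s| < l₀`:
`HasDerivAt (genFunLim (schemeZ S os)) (lim_K G_K′(s)) s` — the tree's `T4CauchySum.tendsto_genFun` (values) + §1 (derivatives, locally uniformly).
At `s = 0` the derivative is the continuum expectation `lim_K ⟨∏os⟩_K` of `…TwoConstantsRate`.  `Target` is a HYPOTHESIS. [folklore] -/
theorem hasDerivAt_genFunLim_of_target {vol l₀ : ℝ} {δ : ℕ → ℝ} (hl₀ : 0 < l₀) (os : List O)
    (hT : NE7.Target vol l₀ δ (schemeZ S os)) {s : ℝ} (hs : |s| < l₀) :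
    HasDerivAt (genFunLim (schemeZ S os)) (limUnder atTop fun K => deriv (genFun (schemeZ S os) K) s) s := by
  obtain ⟨hM, hδ⟩ := hT
  haveI hP : ∀ K, IsProbabilityMeasure (T4GenFunBounds.gibbsMeasure (G := G) (S.P K) (S.β K)) := fun K =>
    T4GenFunBounds.isProbabilityMeasure_gibbsMeasure (G := G) (S.P K) (hβ K)
  have hτ0 : ∀ K, 0 ≤ ∑' j, 2 * (vol * δ (K + j)) := fun K =>
    tsum_nonneg fun j => mul_nonneg two_pos.le (mul_nonneg_of_matchingModConstants hl₀.le hM (K + j))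
  have hτlim : Tendsto (fun K => ∑' j, 2 * (vol * δ (K + j))) atTop (𝓝 0) := by
    have h := tendsto_sum_nat_add fun j => 2 * (vol * δ j)
    refine h.congr fun i => tsum_congr fun k => by rw [add_comm]
  have hfun : ∀ K, genFun (schemeZ S os) K = cgf (prodObs S K os) (T4GenFunBounds.gibbsMeasure (S.P K) (S.β K)) := fun K =>
    funext fun t => T4GenFunBounds.genFun_schemeZ_eq_cgf S hβ hm h1 K os t
  have hτ : ∀ K n (t : ℝ), |t| ≤ l₀ →
      |cgf (prodObs S (K + n) os) (T4GenFunBounds.gibbsMeasure (S.P (K + n)) (S.β (K + n))) t -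
        cgf (prodObs S K os) (T4GenFunBounds.gibbsMeasure (S.P K) (S.β K)) t| ≤ ∑' j, 2 * (vol * δ (K + j)) := fun K n t ht => by
    rw [← hfun, ← hfun]
    exact abs_genFun_add_sub_le_tail hM hl₀.le hδ ht K n
  have hg : ∀ t : ℝ, |t| ≤ l₀ →
      Tendsto (fun K => cgf (prodObs S K os) (T4GenFunBounds.gibbsMeasure (S.P K) (S.β K)) t) atTop (𝓝 (genFunLim (schemeZ S os) t)) :=
    fun t ht => by simpa only [hfun] using tendsto_genFun hM hl₀.le hδ ht
  have key := hasDerivAt_lim_cgf (μ := fun K => T4GenFunBounds.gibbsMeasure (S.P K) (S.β K)) (X := fun K => prodObs S K os)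
    (fun K => T4GenFunBounds.measurable_prodObs S hm K os) (fun K => T4GenFunBounds.abs_prodObs_le_one S h1 K os) hτ0 hτ hτlim hg hs
  have e : (fun K => tiltedMean (prodObs S K os) (T4GenFunBounds.gibbsMeasure (S.P K) (S.β K)) s) =
      fun K => deriv (genFun (schemeZ S os) K) s := funext fun K => (deriv_genFun_schemeZ_eq_tiltedMean S hβ hm h1 K os s).symm
  simpa only [e] using key

/-- Hence `genFunLim (schemeZ S os)` is DIFFERENTIABLE on the open source window `{s | |s| < l₀}` under `Target`. [folklore] -/
theorem differentiableOn_genFunLim_of_target {vol l₀ : ℝ} {δ : ℕ → ℝ} (hl₀ : 0 < l₀) (os : List O)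
    (hT : NE7.Target vol l₀ δ (schemeZ S os)) : DifferentiableOn ℝ (genFunLim (schemeZ S os)) {s | |s| < l₀} :=
  fun _ hs => (hasDerivAt_genFunLim_of_target S hβ hm h1 hl₀ os hT hs).differentiableAt.differentiableWithinAt

/-- … and its derivative there IS the continuum sourced expectation `lim_K G_K′(s)`. [folklore] -/
theorem deriv_genFunLim_of_target {vol l₀ : ℝ} {δ : ℕ → ℝ} (hl₀ : 0 < l₀) (os : List O)
    (hT : NE7.Target vol l₀ δ (schemeZ S os)) {s : ℝ} (hs : |s| < l₀) :
    deriv (genFunLim (schemeZ S os)) s = limUnder atTop fun K => deriv (genFun (schemeZ S os) K) s :=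
  (hasDerivAt_genFunLim_of_target S hβ hm h1 hl₀ os hT hs).deriv

/-- ★★ **`C¹`: THE CONTINUUM SOURCED EXPECTATION IS CONTINUOUS ON THE OPEN SOURCE WINDOW** — `deriv (genFunLim (schemeZ S os))` is continuous on
`{s | |s| < l₀}` under `Target` (locally a uniform limit of the continuous `G_K′`). [folklore] -/
theorem continuousOn_deriv_genFunLim_of_target {vol l₀ : ℝ} {δ : ℕ → ℝ} (hl₀ : 0 < l₀) (os : List O)
    (hT : NE7.Target vol l₀ δ (schemeZ S os)) : ContinuousOn (deriv (genFunLim (schemeZ S os))) {s | |s| < l₀} := by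
  intro s hs
  obtain ⟨l₁, hsl₁, hl⟩ := exists_between (show |s| < l₀ from hs)
  haveI hP : ∀ K, IsProbabilityMeasure (T4GenFunBounds.gibbsMeasure (G := G) (S.P K) (S.β K)) := fun K =>
    T4GenFunBounds.isProbabilityMeasure_gibbsMeasure (G := G) (S.P K) (hβ K)
  -- the uniform limit of the continuous `G_K′` on `|x| ≤ l₁` is continuous there
  have hU := tendstoUniformlyOn_deriv_genFun_of_target S hβ hm h1 hl₀.le hl os hT
  have hcK : ∀ K, Continuous fun x => deriv (genFun (schemeZ S os) K) x := fun K => by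
    have e : (fun x => deriv (genFun (schemeZ S os) K) x) =
        tiltedMean (prodObs S K os) (T4GenFunBounds.gibbsMeasure (S.P K) (S.β K)) :=
      funext fun x => deriv_genFun_schemeZ_eq_tiltedMean S hβ hm h1 K os x
    rw [e]
    exact continuous_tiltedMean (T4GenFunBounds.measurable_prodObs S hm K os) (T4GenFunBounds.abs_prodObs_le_one S h1 K os)
  have hcont : ContinuousOn (fun x => limUnder atTop fun K => deriv (genFun (schemeZ S os) K) x) {x | |x| ≤ l₁} :=
    hU.continuousOn (Frequently.of_forall fun K => (hcK K).continuousOn)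
  have hnhds : {x : ℝ | |x| ≤ l₁} ∈ 𝓝 s :=
    mem_of_superset ((isOpen_lt continuous_abs continuous_const).mem_nhds hsl₁) fun x (hx : |x| < l₁) => hx.le
  have hat : ContinuousAt (fun x => limUnder atTop fun K => deriv (genFun (schemeZ S os) K) x) s := hcont.continuousAt hnhds
  -- on the open window `deriv genFunLim` IS that limit
  have heq : deriv (genFunLim (schemeZ S os)) =ᶠ[𝓝 s] fun x => limUnder atTop fun K => deriv (genFun (schemeZ S os) K) x := by
    filter_upwards [(isOpen_lt continuous_abs continuous_const).mem_nhds hs] with x hx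
    exact deriv_genFunLim_of_target S hβ hm h1 hl₀ os hT hx
  exact (hat.congr_of_eventuallyEq heq).continuousWithinAt

end Scheme

end Summit.QuantumFields.YangMills.BalabanUVNodes.N19SourcedResponse

end
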